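import Literature.NumberTheory.EllipticCurves.KrizLi2019.EisensteinHeegnerLog
import HarnessLib

/-!
# ROUTE U — hypotheses (1b) and (3) of Kriz–Li Thm. 1.20: the character `ψ⁻¹ω` and its zeros

bsd-cm cell, ROUTE U (Theorem U: BSD(49a1^{(D)}, 7) ⇒ full BSD on `𝒞₇`), sequel to
`RouteUPsiD11` (the `ψ`-layer for `D = −11`). Kriz–Li Thm. 1.20 asks, besides the trace
hypothesis, for (1) `ψ(p) ≠ 1` and `(ψ⁻¹ω)(p) ≠ 1` and (3) `ψ(ℓ) ≠ 1`, `(ψ⁻¹ω)(ℓ) ≠ 1` at the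
additive primes `ℓ ≠ p`, where `(ψ⁻¹ω)(a)` is the value of the PRIMITIVE character inducing
`ψ⁻¹ω` (tree `primVal (invMulOmega ψ ω) a`, FMS §2 p. 11). For the ROUTE U characters
`ψ = χ·ω²` (`χ` a non-trivial character mod a prime `q ≠ p`, `ω` Teichmüller) this file proves,
generically in `p`, `q`, `f`:

* `invMulOmega_changeLevel_mul_changeLevel_sq`: `ψ⁻¹ω = χ⁻¹·ω⁻¹` (as characters of level `f·p`);
* `conductor_invMulOmega_eq`: its conductor is `q·p` (conductors `q`, `p` coprime multiply —
  Washington Ch. 3; the product rule is re-derived inline from Mathlib's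
  `conductor_mul_dvd_lcm_conductor`);
* `primVal_eq_zero_of_not_coprime` / `primVal_invMulOmega_ne_one`: hence `(ψ⁻¹ω)(a) = 0 ≠ 1`
  whenever `q ∣ a` or `p ∣ a` — hypotheses (1b) at `a = p` and (3b) at `a = q`;
* `apply_natCast_ne_one_of_not_coprime`: `ψ(a) = 0 ≠ 1` for `(a, f) ≠ 1` — (1a), (3a);
* `ne_one_of_isTeichmullerCharacter`: a Teichmüller character mod `p ≠ 2` is non-trivial;
* the `D = −11` instances (`q = 11`, `p = 7`, `f = 77`): `primVal_invMulOmega_D11_seven_ne_one`,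
  `primVal_invMulOmega_D11_eleven_ne_one`, `psi_D11_eleven_ne_one`.

THEOREMS ONLY; no new definitions, no named facts, no instances (prime `Fact`s are binders).
-/

namespace Summit.BirchSwinnertonDyer.Rank1Residual.X12.O11.RouteU

open DirichletCharacter Literature.NumberTheory.EllipticCurves.KrizLi2019

variable {p : ℕ} [hp : Fact p.Prime]

/-! ## §1 Values of the primitive character off the units -/

/-- `(ψ₁ψ₂)(a) = 0` if `(a, f(ψ₁ψ₂)) ≠ 1` (FMS §2, p. 11: "`ψ(a) = 0` if `(a, f(ψ)) ≠ 1`"), for the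
tree's `primVal`. [cite: KrizLi2019, §2 (p. 11, conventions on primitive characters)] -/
theorem primVal_eq_zero_of_not_coprime {n : ℕ} (χ : DirichletCharacter ℚ_[p] n) (a : ℕ)
    (ha : ¬ a.Coprime χ.conductor) : primVal χ a = 0 := by
  unfold primVal
  exact MulChar.map_nonunit _ (by rwa [ZMod.isUnit_iff_coprime])

/-- `(ψ₁ψ₂)(a) ≠ 1` if `(a, f(ψ₁ψ₂)) ≠ 1`. [cite: KrizLi2019, §2 (p. 11)] -/
theorem primVal_ne_one_of_not_coprime {n : ℕ} (χ : DirichletCharacter ℚ_[p] n) (a : ℕ)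
    (ha : ¬ a.Coprime χ.conductor) : primVal χ a ≠ 1 := by
  rw [primVal_eq_zero_of_not_coprime χ a ha]
  exact zero_ne_one

/-- `ψ(a) = 0 ≠ 1` for `(a, f) ≠ 1` (value of a Dirichlet character mod `f` at a non-unit).
[cite: KrizLi2019, §2 (p. 11)] -/
theorem apply_natCast_ne_one_of_not_coprime {n : ℕ} (ψ : DirichletCharacter ℚ_[p] n) (a : ℕ)
    (ha : ¬ a.Coprime n) : ψ (a : ZMod n) ≠ 1 := by
  rw [MulChar.map_nonunit _ (by rwa [ZMod.isUnit_iff_coprime])]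
  exact zero_ne_one

/-! ## §2 Teichmüller characters are non-trivial (`p ≠ 2`) -/

/-- A Teichmüller character modulo an odd prime is non-trivial: `ω(2) ≡ 2 ≢ 1 (mod p)`.
[cite: Washington1997, §5.1 (ω(a) ≡ a mod p)] -/
theorem ne_one_of_isTeichmullerCharacter (hp2 : p ≠ 2) {ω : DirichletCharacter ℚ_[p] p}
    (hω : IsTeichmullerCharacter ω) : ω ≠ 1 := by
  intro h1
  have hpp : p.Prime := hp.out
  have hp2' : ¬ (p : ℤ) ∣ 2 := by
    intro h
    have h' : p ∣ 2 := by exact_mod_cast h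
    exact hp2 ((Nat.prime_dvd_prime_iff_eq hpp Nat.prime_two).mp h')
  have hT := hω 2 hp2'
  have hu : IsUnit ((2 : ℤ) : ZMod p) := by
    rw [show ((2 : ℤ) : ZMod p) = ((2 : ℕ) : ZMod p) by norm_cast]
    exact (ZMod.isUnit_prime_iff_not_dvd Nat.prime_two).mpr
      (fun h => hp2 ((Nat.prime_dvd_prime_iff_eq Nat.prime_two hpp).mp h).symm)
  rw [h1, MulChar.one_apply hu] at hT
  have hnorm : ‖(1 : ℚ_[p]) - ((2 : ℤ) : ℚ_[p])‖ = 1 := by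
    rw [show (1 : ℚ_[p]) - ((2 : ℤ) : ℚ_[p]) = -((1 : ℕ) : ℚ_[p]) by norm_num, norm_neg]
    exact Padic.norm_natCast_eq_one_iff.mpr (Nat.coprime_one_right p)
  rw [hnorm] at hT
  exact lt_irrefl _ hT

/-- The inverse of a Teichmüller character modulo an odd prime is non-trivial.
[cite: Washington1997, §5.1] -/
theorem inv_ne_one_of_isTeichmullerCharacter (hp2 : p ≠ 2) {ω : DirichletCharacter ℚ_[p] p}
    (hω : IsTeichmullerCharacter ω) : ω⁻¹ ≠ 1 := fun h =>
  ne_one_of_isTeichmullerCharacter hp2 hω (inv_eq_one.mp h)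

/-! ## §3 `ψ⁻¹ω = χ⁻¹·ω⁻¹` and its conductor -/

/-- For `ψ = χ·ω²` (lifted to level `f`), the character `ψ⁻¹ω` of Thm. 1.20 (1), (3) (tree
`invMulOmega ψ ω`, level `f·p`) is `χ⁻¹·ω⁻¹` lifted to level `f·p`.
[cite: KrizLi2019, Thm. 1.20 (p. 7, hypotheses (1) and (3))] -/
theorem invMulOmega_changeLevel_mul_changeLevel_sq {f q : ℕ} (hq : q ∣ f) (hpf : p ∣ f)
    (χ : DirichletCharacter ℚ_[p] q) (ω : DirichletCharacter ℚ_[p] p) :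
    invMulOmega (changeLevel hq χ * changeLevel hpf (ω ^ 2)) ω =
      changeLevel (hq.trans (dvd_mul_right f p)) χ⁻¹ *
        changeLevel (dvd_mul_left p f) ω⁻¹ := by
  unfold invMulOmega
  rw [mul_inv, map_mul, ← map_inv, ← map_inv, ← changeLevel_trans, ← changeLevel_trans, mul_assoc,
    ← map_mul, sq, mul_inv_rev, inv_mul_cancel_right]

/-- **`f(ψ⁻¹ω) = q·p`** for `ψ = χ·ω²` with `χ ≠ 1` mod the prime `q ≠ p` and `ω ≠ 1` mod `p`
(conductors `q` and `p` are coprime, so they multiply: `≤` is Mathlib's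
`conductor_mul_dvd_lcm_conductor`, `≥` from `χ⁻¹ = (χ⁻¹ω⁻¹)·ω`).
[cite: Washington1997, Ch. 3 (conductor of a product of characters of coprime conductor)]
[cite: KrizLi2019, Thm. 1.20 (p. 7)] -/
theorem conductor_invMulOmega_eq {f q : ℕ} [NeZero f] [Fact q.Prime] (hq : q ∣ f) (hpf : p ∣ f)
    (hqp : q ≠ p) (χ : DirichletCharacter ℚ_[p] q) (hχ : χ ≠ 1) (ω : DirichletCharacter ℚ_[p] p)
    (hω : ω ≠ 1) :
    (invMulOmega (changeLevel hq χ * changeLevel hpf (ω ^ 2)) ω).conductor = q * p := by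
  rw [invMulOmega_changeLevel_mul_changeLevel_sq]
  haveI : NeZero (f * p) := ⟨mul_ne_zero (NeZero.ne f) hp.out.ne_zero⟩
  -- a non-trivial character modulo a prime has conductor that prime
  -- (tree `RouteU.conductor_eq_of_prime_of_ne_one`, restated inline to keep the imports built)
  have hprime : ∀ {r : ℕ} (_ : r.Prime) (θ : DirichletCharacter ℚ_[p] r), θ ≠ 1 →
      θ.conductor = r := by
    intro r hr θ hθ
    haveI : NeZero r := ⟨hr.ne_zero⟩
    rcases (Nat.dvd_prime hr).mp (conductor_dvd_level θ) with h | h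
    · exact absurd (eq_one_iff_conductor_eq_one.mpr h) hθ
    · exact h
  set A : DirichletCharacter ℚ_[p] (f * p) := changeLevel (hq.trans (dvd_mul_right f p)) χ⁻¹
    with hAdef
  set B : DirichletCharacter ℚ_[p] (f * p) := changeLevel (dvd_mul_left p f) ω⁻¹ with hBdef
  have hA : A.conductor = q := by
    rw [hAdef, conductor_changeLevel, conductor_inv, hprime Fact.out χ hχ]
  have hB : B.conductor = p := by
    rw [hBdef, conductor_changeLevel, conductor_inv, hprime hp.out ω hω]
  have hcop : A.conductor.Coprime B.conductor := by
    rw [hA, hB]; exact (Nat.coprime_primes Fact.out hp.out).mpr hqp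
  apply Nat.dvd_antisymm
  · have h := conductor_mul_dvd_lcm_conductor A B
    rwa [hcop.lcm_eq_mul, hA, hB] at h
  · have hχd : A.conductor ∣ (A * B).conductor := by
      have h1 : A = (A * B) * B⁻¹ := by rw [mul_assoc, mul_inv_cancel, mul_one]
      have h2 := conductor_mul_dvd_lcm_conductor (A * B) B⁻¹
      rw [← h1, conductor_inv] at h2
      exact hcop.dvd_of_dvd_mul_right (h2.trans (Nat.lcm_dvd_mul _ _))
    have hψd : B.conductor ∣ (A * B).conductor := by
      have h1 : B = (A * B) * A⁻¹ := by rw [mul_comm A B, mul_assoc, mul_inv_cancel, mul_one]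
      have h2 := conductor_mul_dvd_lcm_conductor (A * B) A⁻¹
      rw [← h1, conductor_inv] at h2
      exact hcop.symm.dvd_of_dvd_mul_right (h2.trans (Nat.lcm_dvd_mul _ _))
    have key : A.conductor * B.conductor ∣ (A * B).conductor := hcop.mul_dvd_of_dvd_of_dvd hχd hψd
    rwa [hA, hB] at key

/-- **Hypotheses (1b)/(3b) of Thm. 1.20 for `ψ = χ·ω²`: `(ψ⁻¹ω)(a) ≠ 1` whenever `q ∣ a` or
`p ∣ a`** (the primitive character `χ⁻¹ω⁻¹` has conductor `qp`, so its value there is `0`).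
[cite: KrizLi2019, Thm. 1.20 (1), (3) (p. 7)] -/
theorem primVal_invMulOmega_ne_one {f q : ℕ} [NeZero f] [Fact q.Prime] (hq : q ∣ f) (hpf : p ∣ f)
    (hqp : q ≠ p) (χ : DirichletCharacter ℚ_[p] q) (hχ : χ ≠ 1) (ω : DirichletCharacter ℚ_[p] p)
    (hω : ω ≠ 1) {a : ℕ} (ha : q ∣ a ∨ p ∣ a) :
    primVal (invMulOmega (changeLevel hq χ * changeLevel hpf (ω ^ 2)) ω) a ≠ 1 := by
  apply primVal_ne_one_of_not_coprime
  rw [conductor_invMulOmega_eq hq hpf hqp χ hχ ω hω]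
  intro hc
  rcases ha with h | h
  · exact (Fact.out : q.Prime).one_lt.ne' (Nat.dvd_one.mp (hc ▸ Nat.dvd_gcd h (dvd_mul_right q p)))
  · exact hp.out.one_lt.ne' (Nat.dvd_one.mp (hc ▸ Nat.dvd_gcd h (dvd_mul_left p q)))

/-! ## §4 The `D = −11` instances (`q = 11`, `p = 7`, `f = 77`) -/

/-- **(1b) for `D = −11`: `(ψ⁻¹ω)(7) ≠ 1`** for `ψ = χ_{−11}·ω²` of level `77`
(`χ` any non-trivial character mod `11`, `ω` Teichmüller mod `7`).
[cite: KrizLi2019, Thm. 1.20 (1) (p. 7)] -/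
theorem primVal_invMulOmega_D11_seven_ne_one [Fact (Nat.Prime 7)] [Fact (Nat.Prime 11)]
    (χ : DirichletCharacter ℚ_[7] 11) (hχ : χ ≠ 1) (ω : DirichletCharacter ℚ_[7] 7)
    (hω : IsTeichmullerCharacter ω) :
    primVal (invMulOmega (changeLevel (by norm_num : 11 ∣ 77) χ *
      changeLevel (by norm_num : 7 ∣ 77) (ω ^ 2)) ω) 7 ≠ 1 :=
  haveI : NeZero (77 : ℕ) := ⟨by norm_num⟩
  primVal_invMulOmega_ne_one _ _ (by norm_num) χ hχ ω
    (ne_one_of_isTeichmullerCharacter (by norm_num) hω) (Or.inr (dvd_refl 7))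

/-- **(3b) for `D = −11` at the additive prime `ℓ = 11`: `(ψ⁻¹ω)(11) ≠ 1`.**
[cite: KrizLi2019, Thm. 1.20 (3) (p. 7)] -/
theorem primVal_invMulOmega_D11_eleven_ne_one [Fact (Nat.Prime 7)] [Fact (Nat.Prime 11)]
    (χ : DirichletCharacter ℚ_[7] 11) (hχ : χ ≠ 1) (ω : DirichletCharacter ℚ_[7] 7)
    (hω : IsTeichmullerCharacter ω) :
    primVal (invMulOmega (changeLevel (by norm_num : 11 ∣ 77) χ *
      changeLevel (by norm_num : 7 ∣ 77) (ω ^ 2)) ω) 11 ≠ 1 :=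
  haveI : NeZero (77 : ℕ) := ⟨by norm_num⟩
  primVal_invMulOmega_ne_one _ _ (by norm_num) χ hχ ω
    (ne_one_of_isTeichmullerCharacter (by norm_num) hω) (Or.inl (dvd_refl 11))

/-- **(3a) for `D = −11` at `ℓ = 11`: `ψ(11) ≠ 1`** (`ψ(11) = 0`, `11 ∣ 77`).
[cite: KrizLi2019, Thm. 1.20 (3) (p. 7)] -/
theorem psi_D11_eleven_ne_one [Fact (Nat.Prime 7)] (ψ : DirichletCharacter ℚ_[7] 77) :
    ψ ((11 : ℕ) : ZMod 77) ≠ 1 :=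
  apply_natCast_ne_one_of_not_coprime ψ 11 (by norm_num)

/-- **(1a) for `D = −11`: `ψ(7) ≠ 1`** for ANY character `ψ` mod `77` (`ψ(7) = 0`).
[cite: KrizLi2019, Thm. 1.20 (1) (p. 7)] -/
theorem psi_D11_seven_ne_one [Fact (Nat.Prime 7)] (ψ : DirichletCharacter ℚ_[7] 77) :
    ψ ((7 : ℕ) : ZMod 77) ≠ 1 :=
  apply_natCast_ne_one_of_not_coprime ψ 7 (by norm_num)

end Summit.BirchSwinnertonDyer.Rank1Residual.X12.O11.RouteU
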